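import Literature.NumberTheory.LFunctions.WeilExplicit
import Mathlib.NumberTheory.LSeries.Dirichlet
import Mathlib.NumberTheory.LSeries.Linearity
import Mathlib.NumberTheory.SumPrimeReciprocals
import Mathlib.Tactic.NormNum.Prime

/-!
# `SignCone.ConeMagnification`, line `Sketch`: a CALIBRATION of the open stub `stub_deficit`
(crux stmt-RiemannHypothesis-16303, route route-RiemannHypothesis-SignCone; HELPER file, `--supports`)

The only open stub of the crux skeleton `Cruxes/ConeMagnification/Lines/Sketch.lean` is `stub_deficit`
(W-MAG Thm 1.2(i) of the unpublished 2001 archive, weakened to summability): a weight `c ≥ 0`, `c 1 = 0`,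
with UNIT SLACK against every Weil test, `Σ c(n) n^{-σ} < ∞` (`σ > 1`) and a local holomorphic continuation of
`L_c(s) - 1/(s-1)` to thin rectangles through every point of `re s > 1/2`, has summable one-sided prime
deficit `Σ_p (log p - c(p))₊ p^{-σ}` for every `σ > 1/2`.

This file records, kernel-checked, what ANY proof of that stub must contain.  The constant weight
`𝟙 := (n ↦ if n = 1 then 0 else 1)` satisfies every side hypothesis of the stub UNCONDITIONALLY:
`𝟙 ≥ 0`, `𝟙 1 = 0`, `L_𝟙(s) = ζ(s) - 1` converges absolutely on `re s > 1`
(`lseriesSummable_constWeight`, `lseries_constWeight_eq`), and `L_𝟙(s) - 1/(s-1) = ζ₀(s) - 1` is ENTIRE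
(Mathlib's `riemannZeta₀`, `differentiable_riemannZeta₀`), while its prime deficit
`Σ_p (log p - 1)₊ p^{-σ} ≥ (log 3 - 1) Σ_{p ≥ 3} p^{-1}` DIVERGES for every `σ ≤ 1`
(`not_summable_primeDeficit_constWeight`, from Mathlib's `not_summable_one_div_on_primes`).  Hence
(`exists_weilTest_constWeight_of_stub_deficit`):

  `stub_deficit` ⟹ the constant weight violates unit slack: there is a Weil test `g` with
  `Re (W_ar(g ⋆ g̃) - Σ_{n ≥ 2} n^{-1/2} ((g ⋆ g̃)(log n) + (g ⋆ g̃)(-log n))) < -‖g‖₂²`.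

Read through the contour-shifted form of the fake Weil functional (refuter's crux-attack note, job
j020144: for a weight whose L-series continues to `re s ≥ 1/2` with only the pole at `1`,
`W_c(g ⋆ g̃) + ‖g‖₂² = (1/2π) ∫ |ĝ(t)|² (1 + Re ψ(1/4 + it/2) - log π - 2 Re L_c(1/2 + it)) dt`; here
`L_𝟙 = ζ - 1`), the conclusion says that `2 Re ζ(1/2 + it) > 3 + Re ψ(1/4 + it/2) - log π`
(`≈ 3 + log (t/2π)`) on a set carrying the bulk of `|ĝ|²` for some Weil test `g`: an `Ω₊`-statement for
the REAL PART of `ζ` on the critical line beyond `(1/2) log t + O(1)`.  Such large values are known to exist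
(resonance method, Soundararajan 2008, which bounds `Re ∫ ζ(1/2+it)|R(t)|²Φ(t/T) dt` from below by a
positive main term; numerically the threshold is first crossed near height `t ≈ 10³–10⁴`), but no
statement of this strength is in Mathlib or in the tree: a Lean proof of `stub_deficit` therefore
necessarily contains (the strength of) a large-values theorem for `Re ζ(1/2 + it)`, or a certified
numerical evaluation of one Weil form at such a height.  This bounds the formalisation cost of the stub
from below independently of the unpublished resonator/type inequality, and it is the cheapest test any
proposed proof strategy for the stub must pass (strategies blind to the size of `Re ζ` on the critical
line cannot be complete).

Nothing here is specific to the line `Sketch`: the three side hypotheses are those every architecture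
for the crux derives from unit slack (`stub_chebyshev`, `stub_continuation`), so the same calibration
applies to the deficit input of W-MAG / KtBricks / `landau-pinch` alike.
-/

noncomputable section

-- `Summit.RiemannHypothesis.RiemannHypothesis.…` repeats a namespace component by design (D-0017 layout).
set_option linter.dupNamespace false

open scoped BigOperators
open Complex MeasureTheory Set Filter

namespace Summit.RiemannHypothesis.RiemannHypothesis.Theorems.SignConeConeMagnification

open Literature.NumberTheory.LFunctions

/-! ## The constant weight `𝟙 = (n ↦ if n = 1 then 0 else 1)` satisfies the side hypotheses -/

/-- `Σ 𝟙(n) n^{-σ}` converges absolutely for `σ > 1`: off `n = 1` the weight is the constant sequence `1`,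
whose L-series converges exactly on `re s > 1` (Mathlib `LSeriesSummable_one_iff`). [folklore] -/
theorem lseriesSummable_constWeight {σ : ℝ} (hσ : 1 < σ) :
    LSeriesSummable (fun n => (((if n = 1 then (0 : ℝ) else 1 : ℝ)) : ℂ)) σ := by
  have h1 : LSeriesSummable 1 (σ : ℂ) := LSeriesSummable_one_iff.mpr (by simpa using hσ)
  refine (LSeriesSummable_congr' (σ : ℂ) ?_).mpr h1
  filter_upwards [eventually_ge_atTop 2] with n hn
  have hn1 : n ≠ 1 := by omega
  simp [hn1]

/-- On `re s > 1`, `L_𝟙(s) = ζ(s) - 1` (`𝟙 = 1 - δ`, Mathlib `LSeries_one_eq_riemannZeta`, `LSeries_delta`).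
[folklore] -/
theorem lseries_constWeight_eq {s : ℂ} (hs : 1 < s.re) :
    LSeries (fun n => (((if n = 1 then (0 : ℝ) else 1 : ℝ)) : ℂ)) s = riemannZeta s - 1 := by
  have hfun : (fun n : ℕ => (((if n = 1 then (0 : ℝ) else 1 : ℝ)) : ℂ)) = 1 - LSeries.delta := by
    ext n
    by_cases hn : n = 1 <;> simp [LSeries.delta, hn]
  have h1 : LSeriesSummable 1 s := LSeriesSummable_one_iff.mpr hs
  have hδ : LSeriesSummable LSeries.delta s := by
    refine summable_of_ne_finset_zero (s := {1}) fun n hn => ?_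
    rw [Finset.mem_singleton] at hn
    simp [LSeries.term_delta, hn]
  rw [hfun, LSeries_sub h1 hδ, LSeries_one_eq_riemannZeta hs, congrFun LSeries_delta s, Pi.one_apply]

/-- The continuation datum of the stubs for `𝟙`: `F = ζ₀ - 1` is entire (Mathlib `riemannZeta₀`,
`ζ(s) = (s-1)⁻¹ + ζ₀(s)` off `s = 1`) and equals `L_𝟙(s) - 1/(s-1)` on `re s > 1`. [folklore] -/
theorem continuation_constWeight (s₀ : ℂ) :
    ∃ η : ℝ, 0 < η ∧ ∃ F : ℂ → ℂ,
      DifferentiableOn ℂ F {s : ℂ | 1 / 2 < s.re ∧ s.re < s₀.re + 1 ∧ s₀.im - η < s.im ∧ s.im < s₀.im + η} ∧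
      ∀ s ∈ {s : ℂ | 1 / 2 < s.re ∧ s.re < s₀.re + 1 ∧ s₀.im - η < s.im ∧ s.im < s₀.im + η},
        1 < s.re → F s = LSeries (fun n => (((if n = 1 then (0 : ℝ) else 1 : ℝ)) : ℂ)) s - 1 / (s - 1) := by
  refine ⟨1, one_pos, fun s => riemannZeta₀ s - 1, ?_, fun s _ hs => ?_⟩
  · exact (differentiable_riemannZeta₀.sub (differentiable_const _)).differentiableOn
  · have hs1 : s ≠ 1 := by
      intro h
      rw [h, one_re] at hs
      exact lt_irrefl _ hs
    rw [lseries_constWeight_eq hs, riemannZeta_eq_inv_sub_add hs1, one_div]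
    ring

/-- The prime deficit of `𝟙` is NOT summable at any `σ ≤ 1`: for primes `p ≥ 3`,
`(log p - 1)₊ p^{-σ} ≥ (log 3 - 1) p^{-1}` with `log 3 > 1`, and `Σ_p p^{-1} = ∞`
(Mathlib `not_summable_one_div_on_primes`). [folklore] -/
theorem not_summable_primeDeficit_constWeight {σ : ℝ} (hσ : σ ≤ 1) :
    ¬ Summable (fun p : ℕ =>
      if p.Prime then max (Real.log p - (if p = 1 then (0 : ℝ) else 1)) 0 / (p : ℝ) ^ σ else 0) := by
  intro hS
  have hlog3 : 1 < Real.log 3 := by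
    rw [Real.lt_log_iff_exp_lt (by norm_num)]
    have := Real.exp_one_lt_d9
    linarith
  set κ : ℝ := Real.log 3 - 1 with hκ
  have hκ0 : 0 < κ := by linarith
  refine not_summable_one_div_on_primes ?_
  refine Summable.of_norm_bounded_eventually_nat (hS.mul_left κ⁻¹) ?_
  filter_upwards [eventually_ge_atTop 3] with n hn
  by_cases hp : n.Prime
  · have hn1 : n ≠ 1 := by omega
    have hn0 : (0 : ℝ) < n := by exact_mod_cast (show 0 < n by omega)
    have hn1' : (1 : ℝ) ≤ n := by exact_mod_cast (show 1 ≤ n by omega)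
    rw [Set.indicator_of_mem (Set.mem_setOf.mpr hp)]
    simp only [hp, if_true, hn1, if_false]
    -- `(log n - 1)₊ / n^σ ≥ κ / n`
    have hlogn : κ ≤ Real.log n - 1 := by
      have : Real.log 3 ≤ Real.log n :=
        Real.log_le_log (by norm_num) (by exact_mod_cast hn)
      linarith
    have hmax : κ ≤ max (Real.log n - 1) 0 := hlogn.trans (le_max_left _ _)
    have hrpow : (n : ℝ) ^ σ ≤ n := by
      calc (n : ℝ) ^ σ ≤ (n : ℝ) ^ (1 : ℝ) := Real.rpow_le_rpow_of_exponent_le hn1' hσ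
        _ = n := Real.rpow_one _
    have hrpow0 : 0 < (n : ℝ) ^ σ := Real.rpow_pos_of_pos hn0 _
    have hkey : κ / n ≤ max (Real.log n - 1) 0 / (n : ℝ) ^ σ :=
      div_le_div₀ (le_max_right _ _) hmax hrpow0 hrpow
    rw [Real.norm_eq_abs, abs_of_nonneg (by positivity)]
    calc (1 : ℝ) / n = κ⁻¹ * (κ / n) := by field_simp
      _ ≤ κ⁻¹ * (max (Real.log n - 1) 0 / (n : ℝ) ^ σ) :=
          mul_le_mul_of_nonneg_left hkey (inv_nonneg.mpr hκ0.le)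
  · rw [Set.indicator_of_notMem (fun h => hp (Set.mem_setOf.mp h))]
    simp [hp]

/-! ## The calibration -/

/-- **Calibration of `stub_deficit`.**  If the registered stub `stub_deficit` of crux
stmt-RiemannHypothesis-16303 holds (hypothesis `H`, the stub's signature verbatim), then the constant
weight `𝟙 = (n ↦ if n = 1 then 0 else 1)` is NOT in the unit-slack cone: some Weil test `g` has
`Re (W_ar(g ⋆ g̃) - Σₙ 𝟙(n) n^{-1/2} ((g ⋆ g̃)(log n) + (g ⋆ g̃)(-log n))) < -‖g‖₂²`.  All side
hypotheses of the stub hold for `𝟙` unconditionally (`lseriesSummable_constWeight`,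
`continuation_constWeight`) while its prime deficit diverges at `σ = 1 > 1/2`
(`not_summable_primeDeficit_constWeight`), so unit slack must fail.  Consequently any proof of the
stub proves an `Ω₊`-result for `Re ζ(1/2 + it)` beyond `(3 + Re ψ(1/4 + it/2) - log π)/2` (module
docstring). [folklore] -/
theorem exists_weilTest_constWeight_of_stub_deficit :
    (∀ c : ℕ → ℝ, (∀ n, 0 ≤ c n) → c 1 = 0 →
      (∀ g : ℝ → ℂ, IsWeilTest g →
        -(∫ t, ‖g t‖ ^ 2) ≤
          (weilPolarTerm (weilConv g (weilReflect g)) + weilArchTerm (weilConv g (weilReflect g)) -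
            ∑' n : ℕ, ((c n : ℝ) : ℂ) / (Real.sqrt n : ℂ) *
              (weilConv g (weilReflect g) (Real.log n) + weilConv g (weilReflect g) (-Real.log n))).re) →
      (∀ σ : ℝ, 1 < σ → LSeriesSummable (fun n => ((c n : ℝ) : ℂ)) σ) →
      (∀ s₀ : ℂ, 1 / 2 < s₀.re → ∃ η : ℝ, 0 < η ∧ ∃ F : ℂ → ℂ,
        DifferentiableOn ℂ F {s : ℂ | 1 / 2 < s.re ∧ s.re < s₀.re + 1 ∧ s₀.im - η < s.im ∧ s.im < s₀.im + η} ∧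
        ∀ s ∈ {s : ℂ | 1 / 2 < s.re ∧ s.re < s₀.re + 1 ∧ s₀.im - η < s.im ∧ s.im < s₀.im + η},
          1 < s.re → F s = LSeries (fun n => ((c n : ℝ) : ℂ)) s - 1 / (s - 1)) →
      ∀ σ : ℝ, 1 / 2 < σ →
        Summable (fun p : ℕ => if p.Prime then max (Real.log p - c p) 0 / (p : ℝ) ^ σ else 0)) →
    ∃ g : ℝ → ℂ, IsWeilTest g ∧
      (weilPolarTerm (weilConv g (weilReflect g)) + weilArchTerm (weilConv g (weilReflect g)) -
          ∑' n : ℕ, (((if n = 1 then (0 : ℝ) else 1 : ℝ)) : ℂ) / (Real.sqrt n : ℂ) *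
            (weilConv g (weilReflect g) (Real.log n) + weilConv g (weilReflect g) (-Real.log n))).re <
        -(∫ t, ‖g t‖ ^ 2) := by
  intro H
  by_contra hno
  push Not at hno
  have hdef := H (fun n => if n = 1 then (0 : ℝ) else 1)
    (fun n => by
      show (0 : ℝ) ≤ if n = 1 then 0 else 1
      split_ifs <;> norm_num)
    (by simp) hno (fun σ hσ => lseriesSummable_constWeight hσ)
    (fun s₀ _ => continuation_constWeight s₀) 1 (by norm_num)
  exact not_summable_primeDeficit_constWeight le_rfl hdef


/-! ## Calibration of the reshaped open core `stub_torusOfCara` (skeleton r3)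

Reshape r3 of the line replaced `stub_deficit` by `stub_pdLaplace → stub_cara → stub_torusOfCara →
stub_deficitOfTorus`, the open core being `stub_torusOfCara`: a Carathéodory majorant
`Re (L_c(s) - 1/(s-1)) ≤ 1/2 + Re (1/s) + ½ Re ψ(s/2) - ½ log π` on `re s > 1/2` (for a weight `c ≥ 0`,
`c 1 = 0`, `Σ c(n) n^{-σ} < ∞` for `σ > 1`) should imply the torus inequality
`Σ_{A ⊆ S} (c - Λ)(n_A) n_A^{-1/2} 2^{-|A|} cos(|A| φ) ≤ 1/2` for every finite set `S` of primes.
For the constant weight `𝟙` at `φ = 0` the torus functional is EXPLICIT,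
`Π_{p ∈ S} (1 + 1/(2√p)) - 1 - Σ_{p ∈ S} log p/(2√p)` (`torusSum_constWeight_eq`), and already for
`S = {primes ≤ 41}` it exceeds `1/2` (`one_half_lt_torusSum_constWeight`; numerically `≈ 1.31`).  Hence
(`exists_large_re_riemannZeta0_of_stub_torusOfCara`):

  `stub_torusOfCara` ⟹ `∃ s, re s > 1/2 ∧ Re (ζ₀(s) - 1) > 1/2 + Re (1/s) + ½ Re ψ(s/2) - ½ log π`,

`ζ₀(s) = ζ(s) - 1/(s-1)` (Mathlib `riemannZeta₀`): any proof of the open core proves a LARGE VALUE of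
`Re ζ` in the half-plane `re s > 1/2`, beyond `½ Re ψ(s/2) + O(1) ≈ ½ log |s|` — an `Ω₊`-theorem for the
real part of `ζ` in the critical strip (classical in analysis: resonance / Dirichlet-polynomial methods;
absent from Mathlib and from the tree).  In particular the Riesz product `Π_{p∈S}(1 + cos(t log p))` of
the stub's MODEL docstring, fed the weight `𝟙`, is Soundararajan's resonator, and the display above is the
shape of his lower bound: the open core contains the resonance method as the special case `c = 𝟙`.
-/

/-- The powerset expansion behind the torus functional of `𝟙`: for a finite set `S` of primes and
`x_p = 1/(2√p)`, `Σ_{A ⊆ S} (𝟙(n_A) - Λ(n_A)) n_A^{-1/2} 2^{-|A|} = Π_{p∈S}(1 + x_p) - 1 - Σ_{p∈S} x_p log p`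
(`𝟙(n_A) = 0` iff `A = ∅`; `Λ(n_A) = log p` if `A = {p}` and `0` if `|A| ≠ 1`, `n_A` being squarefree
with `|A|` prime factors; `Finset.prod_one_add`). [folklore] -/
theorem torusSum_constWeight_eq (S : Finset ℕ) (hS : ∀ p ∈ S, p.Prime) :
    ∑ A ∈ S.powerset, ((if (∏ p ∈ A, p) = 1 then (0 : ℝ) else 1) -
        ArithmeticFunction.vonMangoldt (∏ p ∈ A, p)) / Real.sqrt (∏ p ∈ A, (p : ℝ)) *
        (1 / 2) ^ A.card * Real.cos ((A.card : ℝ) * 0) =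
      (∏ p ∈ S, (1 + 1 / (2 * Real.sqrt p))) - 1 - ∑ p ∈ S, Real.log p / (2 * Real.sqrt p) := by
  classical
  -- the weight of a subset: `w A = 2^{-|A|} / √n_A = Π_{p∈A} 1/(2√p)`
  set w : Finset ℕ → ℝ := fun A => ∏ p ∈ A, 1 / (2 * Real.sqrt p) with hw
  have hwA : ∀ A : Finset ℕ, 1 / Real.sqrt (∏ p ∈ A, (p : ℝ)) * (1 / 2) ^ A.card = w A := by
    intro A
    rw [Real.sqrt_prod _ fun p _ => Nat.cast_nonneg p, ← Finset.prod_const, hw,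
      one_div, ← Finset.prod_inv_distrib, ← Finset.prod_mul_distrib]
    refine Finset.prod_congr rfl fun p _ => ?_
    simp only [one_div, mul_inv_rev]
  -- arithmetic of `n_A` for `A ⊆ S`
  have hprime : ∀ A ∈ S.powerset, ∀ p ∈ A, p.Prime := fun A hA p hp =>
    hS p (Finset.mem_powerset.mp hA hp)
  have hone : ∀ A ∈ S.powerset, ((∏ p ∈ A, p) = 1 ↔ A = ∅) := by
    intro A hA
    rw [Finset.prod_eq_one_iff_of_one_le' fun p hp => (hprime A hA p hp).one_lt.le]
    constructor
    · intro h
      rcases A.eq_empty_or_nonempty with h' | ⟨p, hp⟩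
      · exact h'
      · exact absurd (h p hp) (hprime A hA p hp).ne_one
    · rintro rfl p hp
      exact absurd hp (Finset.notMem_empty p)
  have hΛ : ∀ A ∈ S.powerset, A.card ≠ 1 → ArithmeticFunction.vonMangoldt (∏ p ∈ A, p) = 0 := by
    intro A hA hcard
    rw [ArithmeticFunction.vonMangoldt_eq_zero_iff, isPrimePow_iff_card_primeFactors_eq_one,
      Nat.primeFactors_prod (hprime A hA)]
    exact hcard
  -- split the summand as `𝟙(n_A) w A - Λ(n_A) w A`
  have hsplit : ∀ A ∈ S.powerset,
      ((if (∏ p ∈ A, p) = 1 then (0 : ℝ) else 1) - ArithmeticFunction.vonMangoldt (∏ p ∈ A, p)) /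
          Real.sqrt (∏ p ∈ A, (p : ℝ)) * (1 / 2) ^ A.card * Real.cos ((A.card : ℝ) * 0) =
        (w A - (if A = ∅ then w A else 0)) -
          (if A.card = 1 then ArithmeticFunction.vonMangoldt (∏ p ∈ A, p) * w A else 0) := by
    intro A hA
    rw [mul_zero, Real.cos_zero, mul_one, div_eq_mul_one_div, mul_assoc, hwA A]
    by_cases h0 : A = ∅
    · subst h0
      simp [hw]
    · have h1 : ¬ (∏ p ∈ A, p) = 1 := fun h => h0 ((hone A hA).mp h)
      rw [if_neg h1, if_neg h0]
      by_cases hc : A.card = 1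
      · rw [if_pos hc]; ring
      · rw [if_neg hc, hΛ A hA hc]; ring
  rw [Finset.sum_congr rfl hsplit, Finset.sum_sub_distrib, Finset.sum_sub_distrib,
    Finset.sum_ite_eq' S.powerset ∅ w, if_pos (Finset.empty_mem_powerset S), ← Finset.prod_one_add]
  -- `w ∅ = 1` and the `|A| = 1` layer is the sum over the primes of `S`
  have hw0 : w ∅ = 1 := by simp [hw]
  have hlayer : ∑ A ∈ S.powerset,
      (if A.card = 1 then ArithmeticFunction.vonMangoldt (∏ p ∈ A, p) * w A else 0) =
      ∑ p ∈ S, Real.log p / (2 * Real.sqrt p) := by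
    rw [← Finset.sum_filter, ← Finset.powersetCard_eq_filter, Finset.powersetCard_one, Finset.sum_map]
    refine Finset.sum_congr rfl fun p hp => ?_
    simp only [Function.Embedding.coeFn_mk, Finset.prod_singleton, hw]
    rw [ArithmeticFunction.vonMangoldt_apply_prime (hS p hp)]
    ring
  rw [hw0, hlayer]

/-- The torus functional of `𝟙` over the primes `≤ 41` exceeds `1/2`:
`Π_{p ≤ 41}(1 + 1/(2√p)) - 1 - Σ_{p ≤ 41} log p/(2√p) > 1/2` (≈ `6.38 - 1 - 4.07 = 1.31`; certified with
two-decimal square-root brackets and `log p ≤ m log 2 + (p/2^m - 1)`, `log 2 < 0.6931471808`). [folklore] -/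
theorem one_half_lt_torusSum_constWeight :
    (1 / 2 : ℝ) < (∏ p ∈ ({2, 3, 5, 7, 11, 13, 17, 19, 23, 29, 31, 37, 41} : Finset ℕ),
        (1 + 1 / (2 * Real.sqrt p))) - 1 -
      ∑ p ∈ ({2, 3, 5, 7, 11, 13, 17, 19, 23, 29, 31, 37, 41} : Finset ℕ),
        Real.log p / (2 * Real.sqrt p) := by
  -- two-decimal brackets `Rlo p ≤ √p ≤ Rup p` and the exponent `M p ≈ log₂ p`
  let Rup : ℕ → ℝ := fun p => if p = 2 then 1.42 else if p = 3 then 1.74 else if p = 5 then 2.24 else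
    if p = 7 then 2.65 else if p = 11 then 3.32 else if p = 13 then 3.61 else if p = 17 then 4.13 else
    if p = 19 then 4.36 else if p = 23 then 4.80 else if p = 29 then 5.39 else if p = 31 then 5.57 else
    if p = 37 then 6.09 else 6.41
  let Rlo : ℕ → ℝ := fun p => if p = 2 then 1.41 else if p = 3 then 1.73 else if p = 5 then 2.23 else
    if p = 7 then 2.64 else if p = 11 then 3.31 else if p = 13 then 3.60 else if p = 17 then 4.12 else
    if p = 19 then 4.35 else if p = 23 then 4.79 else if p = 29 then 5.38 else if p = 31 then 5.56 else
    if p = 37 then 6.08 else 6.40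
  let M : ℕ → ℕ := fun p => if p < 3 then 1 else if p < 6 then 2 else if p < 12 then 3 else
    if p < 23 then 4 else 5
  -- `log p ≤ m log 2 + (p/2^m - 1)` for every `m`
  have hlog : ∀ (p : ℝ), 0 < p → ∀ m : ℕ, Real.log p ≤ m * 0.6931471808 + (p / 2 ^ m - 1) := by
    intro p hp m
    have h2m : (0 : ℝ) < 2 ^ m := by positivity
    have : Real.log p = m * Real.log 2 + Real.log (p / 2 ^ m) := by
      rw [Real.log_div hp.ne' h2m.ne', Real.log_pow]; ring
    rw [this]
    gcongr
    · exact Real.log_two_lt_d9.le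
    · exact Real.log_le_sub_one_of_pos (by positivity)
  have hmem : ∀ p ∈ ({2, 3, 5, 7, 11, 13, 17, 19, 23, 29, 31, 37, 41} : Finset ℕ),
      Rlo p ≤ Real.sqrt p ∧ Real.sqrt p ≤ Rup p ∧ 0 < Rlo p := by
    intro p hp
    simp only [Finset.mem_insert, Finset.mem_singleton] at hp
    rcases hp with rfl | rfl | rfl | rfl | rfl | rfl | rfl | rfl | rfl | rfl | rfl | rfl | rfl <;>
      exact ⟨(Real.le_sqrt (by norm_num [Rlo]) (by norm_num)).mpr (by norm_num [Rlo]),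
        (Real.sqrt_le_left (by norm_num [Rup])).mpr (by norm_num [Rup]), by norm_num [Rlo]⟩
  -- the product from below
  have hprod : ∏ p ∈ ({2, 3, 5, 7, 11, 13, 17, 19, 23, 29, 31, 37, 41} : Finset ℕ), (1 + 1 / (2 * Rup p)) ≤
      ∏ p ∈ ({2, 3, 5, 7, 11, 13, 17, 19, 23, 29, 31, 37, 41} : Finset ℕ), (1 + 1 / (2 * Real.sqrt p)) := by
    refine Finset.prod_le_prod (fun p hp => ?_) (fun p hp => ?_)
    · have := (hmem p hp).2.2
      have : 0 < Rup p := this.trans_le ((hmem p hp).1.trans (hmem p hp).2.1)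
      positivity
    · obtain ⟨h1, h2, h3⟩ := hmem p hp
      have hsp : 0 < Real.sqrt p := h3.trans_le h1
      gcongr
  -- the logarithmic sum from above
  have hsum : ∑ p ∈ ({2, 3, 5, 7, 11, 13, 17, 19, 23, 29, 31, 37, 41} : Finset ℕ),
      Real.log p / (2 * Real.sqrt p) ≤
      ∑ p ∈ ({2, 3, 5, 7, 11, 13, 17, 19, 23, 29, 31, 37, 41} : Finset ℕ),
        ((M p : ℝ) * 0.6931471808 + ((p : ℝ) / 2 ^ (M p) - 1)) / (2 * Rlo p) := by
    refine Finset.sum_le_sum fun p hp => ?_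
    obtain ⟨h1, h2, h3⟩ := hmem p hp
    have hp0 : (0 : ℝ) < p := by
      have : p.Prime := by
        simp only [Finset.mem_insert, Finset.mem_singleton] at hp
        rcases hp with rfl | rfl | rfl | rfl | rfl | rfl | rfl | rfl | rfl | rfl | rfl | rfl | rfl <;> norm_num
      exact_mod_cast this.pos
    have hlogp : 0 ≤ Real.log p := Real.log_nonneg (by exact_mod_cast (show 0 < p by exact_mod_cast hp0))
    have hnum : Real.log p ≤ (M p : ℝ) * 0.6931471808 + ((p : ℝ) / 2 ^ (M p) - 1) := hlog p hp0 (M p)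
    have hnum0 : 0 ≤ (M p : ℝ) * 0.6931471808 + ((p : ℝ) / 2 ^ (M p) - 1) := hlogp.trans hnum
    calc Real.log p / (2 * Real.sqrt p) ≤ Real.log p / (2 * Rlo p) := by gcongr
      _ ≤ _ := by gcongr
  -- numerics
  have hP : (634 / 100 : ℝ) ≤
      ∏ p ∈ ({2, 3, 5, 7, 11, 13, 17, 19, 23, 29, 31, 37, 41} : Finset ℕ), (1 + 1 / (2 * Rup p)) := by
    simp only [Rup]
    norm_num
  have hL : ∑ p ∈ ({2, 3, 5, 7, 11, 13, 17, 19, 23, 29, 31, 37, 41} : Finset ℕ),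
        ((M p : ℝ) * 0.6931471808 + ((p : ℝ) / 2 ^ (M p) - 1)) / (2 * Rlo p) ≤ 437 / 100 := by
    simp only [Rlo, M]
    norm_num
  linarith

/-- **Calibration of the open core `stub_torusOfCara`.**  If the registered stub `stub_torusOfCara`
(skeleton r3 of crux stmt-RiemannHypothesis-16303; hypothesis `H`, its signature verbatim) holds, then the
entire function `ζ₀ - 1 = (ζ(s) - 1/(s-1)) - 1` — which IS `L_𝟙(s) - 1/(s-1)` on `re s > 1`
(`lseries_constWeight_eq`) — violates the Carathéodory majorant somewhere in `re s > 1/2`: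
`Re (ζ₀(s) - 1) > 1/2 + Re(1/s) + ½ Re ψ(s/2) - ½ log π`.  (Else `H` applied to `c = 𝟙`, `F = ζ₀ - 1`,
`S = {primes ≤ 41}`, `φ = 0` would bound the torus functional of `𝟙` by `1/2`, contradicting
`one_half_lt_torusSum_constWeight`.)  So the open core is at least an `Ω₊`-theorem for `Re ζ` in the
strip beyond `½ Re ψ(s/2) + O(1)` (module docstring). [folklore] -/
theorem exists_large_re_riemannZeta0_of_stub_torusOfCara :
    (∀ c : ℕ → ℝ, (∀ n, 0 ≤ c n) → c 1 = 0 →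
      (∀ σ : ℝ, 1 < σ → LSeriesSummable (fun n => ((c n : ℝ) : ℂ)) σ) →
      (∃ F : ℂ → ℂ, DifferentiableOn ℂ F {s : ℂ | 1 / 2 < s.re} ∧
        (∀ s : ℂ, 1 < s.re → F s = LSeries (fun n => ((c n : ℝ) : ℂ)) s - 1 / (s - 1)) ∧
        ∀ s : ℂ, 1 / 2 < s.re →
          (F s).re ≤ 1 / 2 + (1 / s).re + (Complex.digamma (s / 2)).re / 2 - Real.log Real.pi / 2) →
      ∀ S : Finset ℕ, (∀ p ∈ S, p.Prime) → ∀ φ : ℝ,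
        ∑ A ∈ S.powerset, (c (∏ p ∈ A, p) - ArithmeticFunction.vonMangoldt (∏ p ∈ A, p)) /
            Real.sqrt (∏ p ∈ A, (p : ℝ)) * (1 / 2) ^ A.card * Real.cos ((A.card : ℝ) * φ) ≤ 1 / 2) →
    ∃ s : ℂ, 1 / 2 < s.re ∧
      1 / 2 + (1 / s).re + (Complex.digamma (s / 2)).re / 2 - Real.log Real.pi / 2 <
        (riemannZeta₀ s - 1).re := by
  intro H
  by_contra hno
  push Not at hno
  have hS : ∀ p ∈ ({2, 3, 5, 7, 11, 13, 17, 19, 23, 29, 31, 37, 41} : Finset ℕ), p.Prime := by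
    intro p hp
    simp only [Finset.mem_insert, Finset.mem_singleton] at hp
    rcases hp with rfl | rfl | rfl | rfl | rfl | rfl | rfl | rfl | rfl | rfl | rfl | rfl | rfl <;> norm_num
  have hT := H (fun n => if n = 1 then (0 : ℝ) else 1)
    (fun n => by
      show (0 : ℝ) ≤ if n = 1 then 0 else 1
      split_ifs <;> norm_num)
    (by simp) (fun σ hσ => lseriesSummable_constWeight hσ)
    ⟨fun s => riemannZeta₀ s - 1,
      (differentiable_riemannZeta₀.sub (differentiable_const _)).differentiableOn,
      fun s hs => by
        have hs1 : s ≠ 1 := by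
          intro h
          rw [h, one_re] at hs
          exact lt_irrefl _ hs
        rw [lseries_constWeight_eq hs, riemannZeta_eq_inv_sub_add hs1, one_div]
        ring,
      hno⟩
    {2, 3, 5, 7, 11, 13, 17, 19, 23, 29, 31, 37, 41} hS 0
  have hlt := one_half_lt_torusSum_constWeight
  rw [← torusSum_constWeight_eq _ hS] at hlt
  exact absurd hT (not_le.mpr hlt)

end Summit.RiemannHypothesis.RiemannHypothesis.Theorems.SignConeConeMagnification

end
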